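import Literature.AnabelianGeometry.EtaleTheta.SettingModelKrullCuspCommTerminalC
import HarnessLib

/-!
# The commensurator of the `X`-cusp decomposition group in `Π^tp_C` IS the orbicurve's cusp decomposition group
# `D_C = inclX(D_x) ⊔ inclX(D_x)·g₁` (index `2`), and `D_C` is commensurably terminal ([SemiAnbd] Thm 6.5 (ii) for `C`)

Mochizuki, *The étale theta function …*, Publ. RIMS **45** (2009) [EtTh], Def. 1.7 p. 27 («`C^log` … the stack-theoretic quotient of
`X^log` by the natural action of `±1`»), §2 p. 36 («`Π_X ⊆ Π_C`»); [SemiAnbd] Thm. 6.5 (ii) p. 71 («`D_x` is commensurably terminal»)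
[cite: MochizukiSemiAnbd2006, Thm 6.5 (ii) p.71]. Cell abc-iut, layer L2 (NV lane), seat abc-iut-L2-t5 (gen 7), sequel to
`SettingModelKrullCuspCommTerminalC` (p450247: `g₁ := inclX(Γ₀)·ε_±` centralises `inclX(H)`; C7d over `Π^tp_Ċ` ⇔ `g₁ ∉ Π^tp_Ċ`).
PROOF-ONLY (0 definitions): the orbicurve cusp decomposition group is Mathlib's `Subgroup.Commensurable.commensurator (H.map inclX)`.

RESULTS (any `M : MuTwoSetting p`, `H ≤ Π^tp_X` commensurably terminal in `Π^tp_X`, `Γ₀` with `ε_±·inclX(d)·ε_±⁻¹ = inclX(Γ₀⁻¹dΓ₀)` on `H`):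
* `mem_commensurator_map_inclX_iff` — **`Comm_{Π^tp_C}(inclX H) = inclX(H) ∪ inclX(H)·g₁`**: `g` commensurates `inclX(H)` iff `g ∈ inclX(H)`
  or `g·g₁⁻¹ ∈ inclX(H)`;
* `sqrt_mem_commensurator_map_inclX`, `commensurator_map_inclX_ne` — `g₁ ∈ Comm ∖ inclX(H)`: the cusp of `C = X/±1` below `x` is an
  ORBIFOLD cusp (ramification index `2`), its decomposition group strictly contains `inclX(D_x)`;
* `commensurator_map_inclX_inf_range` (`Comm ∩ inclX(Π^tp_X) = inclX(H)`), `commensurable_commensurator_map_inclX` (index `≤ 2`);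
* **`isCommensurablyTerminal_commensurator_map_inclX`** — `D_C := Comm_{Π^tp_C}(inclX H)` is COMMENSURABLY TERMINAL in `Π^tp_C`
  (commensurable subgroups have equal commensurators);
* instances at `inversionModelκ′` (`H = D_x = c^Ẑ ⋊ G_{ℚ_p}`, `Γ₀ = inl(ab)`, p447351/p450247 BY NAME): `mem_commensurator_cuspDecompκ_C_iff`,
  **`isCommensurablyTerminal_commensurator_cuspDecompκ_C`**, `commensurator_cuspDecompκ_C_ne`.
READING: a C7d-compliant `DotCCusp.pair.D` at a configuration where `g₁ ∈ Π^tp_Ċ` (e.g. `inversionModelκ′`, `ε_Z = a`) is `D_C ∩ Π^tp_Ċ = D_C`,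
not `inclX(D_x)`. SEMI-SYNTHETIC carriers = consistency evidence only; classical group theory under OUR kernel check; nothing of
[EtTh]/[SemiAnbd] asserted; no side taken on [IUTchIII] Cor. 3.12; typed ≠ proved.
-/

noncomputable section

open scoped Pointwise

namespace Literature.AnabelianGeometry.EtaleTheta

open Literature.AnabelianGeometry.AbsoluteAnabelian Function

namespace MuTwoSetting

variable {p : ℕ} [Fact p.Prime] {M : MuTwoSetting p} {H : Subgroup M.PiTemp} {Γ₀ : M.PiTemp}

/-- **`Comm_{Π^tp_C}(inclX H) = inclX(H) ∪ inclX(H)·g₁`** (`g₁ = inclX(Γ₀)·ε_±`): for `H` commensurably terminal in `Π^tp_X`, an element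
of `Π^tp_C` commensurates `inclX(H)` iff it lies in `inclX(H)` or in the coset `inclX(H)·g₁`. [cite: MochizukiSemiAnbd2006, Thm 6.5 (ii) p.71] -/
theorem mem_commensurator_map_inclX_iff (hCT : IsCommensurablyTerminal H)
    (hΓ₀ : ∀ d ∈ H, M.epsPM * M.inclX d * M.epsPM⁻¹ = M.inclX (Γ₀⁻¹ * d * Γ₀)) (g : M.GtpC) :
    g ∈ Subgroup.Commensurable.commensurator (H.map M.inclX) ↔
      g ∈ H.map M.inclX ∨ g * (M.inclX Γ₀ * M.epsPM)⁻¹ ∈ H.map M.inclX := by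
  rw [Subgroup.Commensurable.commensurator_mem_iff, ← SettingModel.conj_smul_eq_toConjAct_smul]
  constructor
  · intro hc
    rcases M.mem_range_inclX_or_mul_epsPM_inv_mem g with ⟨h, rfl⟩ | ⟨h, hh⟩
    · rw [← Literature.IUT.HodgeTheaters.map_conj_smul, commensurable_map_inclX_iff] at hc
      exact Or.inl ⟨h, SettingModel.mem_of_isCommensurablyTerminal hCT hc, rfl⟩
    · have hg' : g = M.inclX h * M.epsPM := by rw [hh, inv_mul_cancel_right]
      rw [hg', map_mul, mul_smul, epsPM_conj_smul_map_inclX hΓ₀, ← Literature.IUT.HodgeTheaters.map_conj_smul, ← mul_smul,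
        ← map_mul, commensurable_map_inclX_iff] at hc
      refine Or.inr ⟨h * Γ₀⁻¹, SettingModel.mem_of_isCommensurablyTerminal hCT hc, ?_⟩
      rw [hg', map_mul, map_inv]; group
  · rintro (hg | hg)
    · rw [Subgroup.conj_smul_eq_self_of_mem hg]
    · have hdec : g = g * (M.inclX Γ₀ * M.epsPM)⁻¹ * (M.inclX Γ₀ * M.epsPM) := by group
      rw [hdec, map_mul, mul_smul, sqrt_conj_smul_map_inclX hΓ₀, Subgroup.conj_smul_eq_self_of_mem hg]

variable (H Γ₀) in
/-- **`g₁ ∈ Comm_{Π^tp_C}(inclX H)`** (it centralises `inclX(H)`). [cite: MochizukiSemiAnbd2006, Thm 6.5 (ii) p.71] -/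
theorem sqrt_mem_commensurator_map_inclX (hΓ₀ : ∀ d ∈ H, M.epsPM * M.inclX d * M.epsPM⁻¹ = M.inclX (Γ₀⁻¹ * d * Γ₀)) :
    M.inclX Γ₀ * M.epsPM ∈ Subgroup.Commensurable.commensurator (H.map M.inclX) := by
  rw [Subgroup.Commensurable.commensurator_mem_iff, ← SettingModel.conj_smul_eq_toConjAct_smul, sqrt_conj_smul_map_inclX hΓ₀]

variable (H Γ₀) in
/-- **The orbicurve cusp decomposition group strictly contains `inclX(D_x)`** (the cusp of `C = X/±1` has ramification index `2` over
`X`): `Comm_{Π^tp_C}(inclX H) ≠ inclX(H)`. [cite: MochizukiEtTh2009, Def 1.7 p.27] -/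
theorem commensurator_map_inclX_ne (hΓ₀ : ∀ d ∈ H, M.epsPM * M.inclX d * M.epsPM⁻¹ = M.inclX (Γ₀⁻¹ * d * Γ₀)) :
    Subgroup.Commensurable.commensurator (H.map M.inclX) ≠ H.map M.inclX := fun h =>
  sqrt_not_mem_map_inclX H Γ₀ (h ▸ sqrt_mem_commensurator_map_inclX H Γ₀ hΓ₀)

/-- `inclX(H) ≤ Comm_{Π^tp_C}(inclX H)`. [cite: MochizukiSemiAnbd2006, Thm 6.5 (ii) p.71] -/
theorem map_inclX_le_commensurator : H.map M.inclX ≤ Subgroup.Commensurable.commensurator (H.map M.inclX) := fun g hg => by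
  rw [Subgroup.Commensurable.commensurator_mem_iff, ← SettingModel.conj_smul_eq_toConjAct_smul, Subgroup.conj_smul_eq_self_of_mem hg]

/-- **`Comm_{Π^tp_C}(inclX H) ∩ inclX(Π^tp_X) = inclX(H)`** (the coset `inclX(H)·g₁` lies off `X`). [cite: MochizukiSemiAnbd2006, Thm 6.5 (ii) p.71] -/
theorem commensurator_map_inclX_inf_range (hCT : IsCommensurablyTerminal H)
    (hΓ₀ : ∀ d ∈ H, M.epsPM * M.inclX d * M.epsPM⁻¹ = M.inclX (Γ₀⁻¹ * d * Γ₀)) :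
    Subgroup.Commensurable.commensurator (H.map M.inclX) ⊓ M.inclX.range = H.map M.inclX := by
  refine le_antisymm ?_ (le_inf map_inclX_le_commensurator (Subgroup.map_le_range _ _))
  rintro g ⟨hg, hgX⟩
  rcases (mem_commensurator_map_inclX_iff hCT hΓ₀ g).mp hg with h | ⟨d, hd, hdg⟩
  · exact h
  · exfalso
    apply M.epsPM_not_mem
    -- `ε_± = Γ₀⁻¹·d⁻¹·g` with all three factors over `X`
    have key : M.epsPM = (M.inclX Γ₀)⁻¹ * (M.inclX d)⁻¹ * g := by
      rw [hdg]; group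
    rw [key]
    exact M.inclX.range.mul_mem (M.inclX.range.mul_mem (M.inclX.range.inv_mem ⟨Γ₀, rfl⟩) (M.inclX.range.inv_mem ⟨d, rfl⟩)) hgX

/-- **`[Comm : inclX(H)] ≤ 2`**: the orbicurve decomposition group is commensurable with `inclX(H)` (its trace on the index-`2` subgroup
`inclX(Π^tp_X)` is `inclX(H)`). [cite: MochizukiSemiAnbd2006, Thm 6.5 (ii) p.71] -/
theorem commensurable_commensurator_map_inclX (hCT : IsCommensurablyTerminal H)
    (hΓ₀ : ∀ d ∈ H, M.epsPM * M.inclX d * M.epsPM⁻¹ = M.inclX (Γ₀⁻¹ * d * Γ₀)) :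
    Subgroup.Commensurable (Subgroup.Commensurable.commensurator (H.map M.inclX)) (H.map M.inclX) := by
  haveI : M.inclX.range.Normal := M.range_inclX_normal
  set C := Subgroup.Commensurable.commensurator (H.map M.inclX) with hC
  have hle : H.map M.inclX ≤ C := map_inclX_le_commensurator
  have h1 : C.relIndex (H.map M.inclX) = 1 := Subgroup.relIndex_eq_one.mpr hle
  -- `[C : inclX H] ∣ [Π^tp_C : inclX Π^tp_X] = 2`
  have h2 : (H.map M.inclX).relIndex C = M.inclX.range.relIndex C := by
    have hinf : M.inclX.range ⊓ C = H.map M.inclX := by rw [inf_comm, hC, commensurator_map_inclX_inf_range hCT hΓ₀]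
    rw [← hinf]
    exact Subgroup.inf_relIndex_right _ _
  have h3 : M.inclX.range.relIndex C ∣ 2 := by
    rw [← M.index_range_inclX]
    exact Subgroup.relIndex_dvd_index_of_normal M.inclX.range C
  have h4 : M.inclX.range.relIndex C ≠ 0 := fun h0 => by
    rw [h0, zero_dvd_iff] at h3
    exact two_ne_zero h3
  unfold Subgroup.Commensurable
  exact ⟨by rw [h1]; exact one_ne_zero, by rw [h2]; exact h4⟩

/-- **The ORBICURVE cusp decomposition group `D_C := Comm_{Π^tp_C}(inclX D_x)` is COMMENSURABLY TERMINAL in `Π^tp_C`** ([SemiAnbd]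
Thm 6.5 (ii) for the cusp of `C`): commensurable subgroups have the same commensurator. [cite: MochizukiSemiAnbd2006, Thm 6.5 (ii) p.71] -/
theorem isCommensurablyTerminal_commensurator_map_inclX (hCT : IsCommensurablyTerminal H)
    (hΓ₀ : ∀ d ∈ H, M.epsPM * M.inclX d * M.epsPM⁻¹ = M.inclX (Γ₀⁻¹ * d * Γ₀)) :
    IsCommensurablyTerminal (Subgroup.Commensurable.commensurator (H.map M.inclX)) :=
  ⟨(commensurable_commensurator_map_inclX hCT hΓ₀).eq⟩

/-- The C7d SHAPE for `D_C` over ALL of `Π^tp_C` (a fortiori over every `Π^tp_Ċ`). [cite: MochizukiSemiAnbd2006, Thm 6.5 (ii) p.71] -/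
theorem commensurator_map_inclX_commTerminal (hCT : IsCommensurablyTerminal H)
    (hΓ₀ : ∀ d ∈ H, M.epsPM * M.inclX d * M.epsPM⁻¹ = M.inclX (Γ₀⁻¹ * d * Γ₀)) (g : M.GtpC)
    (hg : Subgroup.Commensurable (MulAut.conj g • Subgroup.Commensurable.commensurator (H.map M.inclX))
      (Subgroup.Commensurable.commensurator (H.map M.inclX))) :
    g ∈ Subgroup.Commensurable.commensurator (H.map M.inclX) :=
  SettingModel.mem_of_isCommensurablyTerminal (isCommensurablyTerminal_commensurator_map_inclX hCT hΓ₀) hg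

end MuTwoSetting

/-! ## At `inversionModelκ′`: the cusp decomposition group of the orbicurve `C` -/

namespace SettingModel

variable (p : ℕ) [Fact p.Prime]

/-- **`Comm_{Π^tp_C}(inclX D_x) = inclX(D_x) ∪ inclX(D_x)·g₁` at `inversionModelκ′`** (`Π^tp_C = PiCInvκ p`, `inclX = inclInvκ p`,
`g₁ = inclX(inl(ab))·ε_±` the square root of the cusp generator, p450247 `sqrtCuspκ_sq`). [cite: MochizukiSemiAnbd2006, Thm 6.5 (ii) p.71] -/
theorem mem_commensurator_cuspDecompκ_C_iff (g : PiCInvκ p) :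
    g ∈ Subgroup.Commensurable.commensurator ((cuspDecompκ p).map (inclInvκ p)) ↔
      g ∈ (cuspDecompκ p).map (inclInvκ p) ∨
        g * (inclInvκ p (SemidirectProduct.inl (gfpOf (FreeGroup.of 0 * FreeGroup.of 1))) * epsPMInvκ p)⁻¹ ∈
          (cuspDecompκ p).map (inclInvκ p) :=
  MuTwoSetting.mem_commensurator_map_inclX_iff (M := MuTwoSetting.inversionModelκ' p) (isCommensurablyTerminal_cuspDecompκ p)
    (epsPM_conj_inclX_of_mem_cuspDecompκ p) g

/-- **The orbicurve cusp decomposition group at `inversionModelκ′` is commensurably terminal in `Π^tp_C`.**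
[cite: MochizukiSemiAnbd2006, Thm 6.5 (ii) p.71] -/
theorem isCommensurablyTerminal_commensurator_cuspDecompκ_C :
    IsCommensurablyTerminal (Subgroup.Commensurable.commensurator ((cuspDecompκ p).map (inclInvκ p))) :=
  MuTwoSetting.isCommensurablyTerminal_commensurator_map_inclX (M := MuTwoSetting.inversionModelκ' p)
    (isCommensurablyTerminal_cuspDecompκ p) (epsPM_conj_inclX_of_mem_cuspDecompκ p)

/-- … it is commensurable with, but different from, `inclX(D_x)` (index `2`: orbifold cusp). [cite: MochizukiEtTh2009, Def 1.7 p.27] -/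
theorem commensurator_cuspDecompκ_C_ne :
    Subgroup.Commensurable.commensurator ((cuspDecompκ p).map (inclInvκ p)) ≠ (cuspDecompκ p).map (inclInvκ p) ∧
      Subgroup.Commensurable (Subgroup.Commensurable.commensurator ((cuspDecompκ p).map (inclInvκ p)))
        ((cuspDecompκ p).map (inclInvκ p)) :=
  ⟨MuTwoSetting.commensurator_map_inclX_ne (M := MuTwoSetting.inversionModelκ' p) (cuspDecompκ p) _
      (epsPM_conj_inclX_of_mem_cuspDecompκ p),
    MuTwoSetting.commensurable_commensurator_map_inclX (M := MuTwoSetting.inversionModelκ' p)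
      (isCommensurablyTerminal_cuspDecompκ p) (epsPM_conj_inclX_of_mem_cuspDecompκ p)⟩

/-- The trace on `X`: `Comm_{Π^tp_C}(inclX D_x) ∩ inclX(Π^tp_X) = inclX(D_x)`. [cite: MochizukiSemiAnbd2006, Thm 6.5 (ii) p.71] -/
theorem commensurator_cuspDecompκ_C_inf_range :
    Subgroup.Commensurable.commensurator ((cuspDecompκ p).map (inclInvκ p)) ⊓ (inclInvκ p).range =
      (cuspDecompκ p).map (inclInvκ p) :=
  MuTwoSetting.commensurator_map_inclX_inf_range (M := MuTwoSetting.inversionModelκ' p) (isCommensurablyTerminal_cuspDecompκ p)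
    (epsPM_conj_inclX_of_mem_cuspDecompκ p)

end SettingModel

end Literature.AnabelianGeometry.EtaleTheta

end
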